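import Literature.NumberTheory.GaloisRepresentations.DifferentSubfieldJump
import HarnessLib

/-!
# No `(ℤ/2ℤ)³`-extension is totally ramified over an absolutely unramified prime with residue field `𝔽₂`

The `p = 2` core of the Hilbert–Speiser proof of the Kronecker–Weber theorem (Marcus,
*Number Fields*, Ch. 4, Ex. 32–33), in the relative Dedekind setting `R ⊆ K ⊆ L`, `S = S_L` the
integral closure of `R` in the Galois extension `L/K`:

* `exists_emultiplicity_differentIdeal_eq_of_card_eq_four` — for `G = Gal(L/K)` abelian of
  order `8`, `𝔓` totally ramified with `2 ∈ 𝔓`, `2 ∉ 𝔭²`, and `H ≤ G` of order `4` (fixed field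
  `F` quadratic over `K`): `v_𝔓(𝔇_{S/R}) = Σ_{s ∈ H ∖ 1} i_G(s) + 4·d` with
  `d = v_{𝔓_F}(𝔇_{S_F/R}) ∈ {2, 3}` (transitivity of the different along `F`, Hilbert's formula,
  and Ex. 33 for the quadratic field `F`).
* `card_zpowers_sup_zpowers` — two distinct commuting involutions generate a Klein four-group.
* `not_totally_ramified_of_card_eq_eight` — if moreover `G` has exponent `2` and `#(S/𝔓) = 2`,
  this is impossible: comparing the different along three Klein subgroups adapted to the
  ramification filtration contradicts the strict increase of the jumps.

Over `ℚ` (with `R = ℤ`, `𝔭 = (2)`): no abelian number field with group `(ℤ/2ℤ)³` is totally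
ramified at `2`; this is what forces the `2`-power layer in Ex. 32 into `ℚ(ζ_{2^m})`.

## References

* D. A. Marcus, *Number Fields*, 2nd ed. (2018), Ch. 4, Ex. 32–34 (pp. 101–102). [Marcus2018]
* J.-P. Serre, *Local Fields* (1979), Ch. IV §1, Prop. 4 (Hilbert's different formula).
  [SerreLocalFields1979]
-/

open Polynomial
open scoped Pointwise IsMulCommutative

noncomputable section

namespace Literature.NumberTheory.GaloisRepresentations

variable (R : Type*) {K L : Type*} [CommRing R] [IsDedekindDomain R] [Field K] [Field L]
  [Algebra R K] [IsFractionRing R K] [Algebra R L] [Algebra K L] [IsScalarTower R K L]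
  [FiniteDimensional K L] [IsGalois K L]

/-- **The different along a quadratic subfield, at the prime `2`.**  In the setting of
`emultiplicity_differentIdeal_eq_finsum_add_card_mul` with `L/K` abelian of degree `8`, `𝔓`
totally ramified of residue characteristic `2 ∈ 𝔓` with `2 ∉ 𝔭²`, and a subgroup `H ≤ G` of
order `4` (fixed field `F = L^H` quadratic over `K`): `v_𝔓(𝔇_{S/R}) = Σ_{s ∈ H, s ≠ 1} i_G(s) + 4 d`
with `d = v_{𝔓_F}(𝔇_{S_F/R}) ∈ {2, 3}` (`exists_jump_of_prime_degree` for `p = 2`).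
[cite: Marcus2018, Ch. 4, Ex. 32–34] -/
theorem exists_emultiplicity_differentIdeal_eq_of_card_eq_four
    [IsDedekindDomain (integralClosure R L)] [Module.IsTorsionFree R (integralClosure R L)]
    [IsMulCommutative (L ≃ₐ[K] L)]
    (𝔓 : Ideal (integralClosure R L)) [𝔓.IsMaximal] (h𝔓 : 𝔓 ≠ ⊥)
    [Finite (integralClosure R L ⧸ 𝔓)] (hcard : Nat.card (L ≃ₐ[K] L) = 8)
    (htot : 𝔓.inertia (L ≃ₐ[K] L) = ⊤)
    (hpP : (2 : integralClosure R L) ∈ 𝔓) (hp𝔭 : (2 : R) ∉ (𝔓.under R) ^ 2)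
    (H : Subgroup (L ≃ₐ[K] L)) (hH : Nat.card H = 4) :
    ∃ d : ℕ, (d = 2 ∨ d = 3) ∧
      emultiplicity 𝔓 (differentIdeal R (integralClosure R L)) =
        (∑ᶠ (s : L ≃ₐ[K] L) (_ : s ∈ H ∧ s ≠ 1), lowerIndex 𝔓 (L ≃ₐ[K] L) s) + ((4 * d : ℕ) : ℕ∞) := by
  classical
  have hp : (2 : ℕ).Prime := Nat.prime_two
  haveI h𝔓prime : 𝔓.IsPrime := Ideal.IsMaximal.isPrime inferInstance
  haveI : FaithfulSMul (L ≃ₐ[K] L) (integralClosure R L) := faithfulSMul_algEquiv_integralClosure R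
  haveI : IsFractionRing (integralClosure R L) L :=
    integralClosure.isFractionRing_of_finite_extension K L
  have hHi : H.index = 2 := by
    have h1 := H.card_mul_index
    rw [hH, hcard] at h1
    omega
  -- the fixed field `F = L^H`, quadratic over `K`, and the tower `R → S_F → S_L`
  set F : IntermediateField K L := IntermediateField.fixedField H with hF
  have hΓ : F.fixingSubgroup = H := IntermediateField.fixingSubgroup_fixedField H
  haveI : H.Normal := inferInstance
  haveI : IsGalois K F := IsGalois.of_fixedField_normal_subgroup H
  letI := integralClosureAlgebra R F (L := L)
  haveI := integralClosure_isScalarTower_left R F (L := L)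
  haveI := integralClosure_isScalarTower_bot R F (L := L)
  haveI := integralClosure_faithfulSMul R F (L := L)
  haveI := integralClosure_isIntegral R F (L := L)
  haveI := isMaximal_under_integralClosure R F 𝔓 (K := K) (L := L)
  haveI : IsFractionRing (integralClosure R F) F :=
    integralClosure.isFractionRing_of_finite_extension K F
  haveI : IsDedekindDomain (integralClosure R F) := integralClosure.isDedekindDomain R K F
  haveI hfR : FaithfulSMul R (integralClosure R F) := faithfulSMul_integralClosure R (K := K) (L := F)
  haveI : Module.IsTorsionFree R (integralClosure R F) := by
    rw [Module.isTorsionFree_iff_faithfulSMul]; infer_instance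
  have hD : F.fixingSubgroup ≤ 𝔓.decompositionSubgroup (L ≃ₐ[K] L) := fun g _ =>
    𝔓.inertia_le_stabilizer (htot ▸ Subgroup.mem_top g)
  have hE1 := emultiplicity_differentIdeal_eq_finsum_add_card_mul R F 𝔓 h𝔓 hD
  -- `#(T_𝔓 ∩ H) = #H = 4`
  have he : Nat.card (𝔓.inertia F.fixingSubgroup) = 4 := by
    have htop : 𝔓.inertia F.fixingSubgroup = ⊤ := by
      rw [eq_top_iff]
      intro g _ x
      exact (show (g : L ≃ₐ[K] L) ∈ 𝔓.inertia (L ≃ₐ[K] L) from htot ▸ Subgroup.mem_top _) x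
    rw [htop, Subgroup.card_top, hΓ, hH]
  -- the hypotheses of Ex. 33 for `F/K` at `𝔓_F`
  have hpF : 𝔓.under (integralClosure R F) ≠ ⊥ := Ideal.IsIntegral.comap_ne_bot _ h𝔓
  haveI : Finite (integralClosure R F ⧸ 𝔓.under (integralClosure R F)) :=
    Finite.of_injective _ Ideal.algebraMap_quotient_injective
  have hcardF : Nat.card (F ≃ₐ[K] F) = 2 := by
    rw [IsGalois.card_aut_eq_finrank, hF, finrank_fixedField_eq_card_quotient, ← Subgroup.index,
      hHi]
  have htotF : (𝔓.under (integralClosure R F)).inertia (F ≃ₐ[K] F) = ⊤ := by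
    have h1 := map_inertia_restrictNormalHom R F 𝔓
    rw [htot, Subgroup.map_top_of_surjective _ (AlgEquiv.restrictNormalHom_surjective L)] at h1
    have h2 : 𝔓.comap (F.integralClosureInclusion R) = 𝔓.under (integralClosure R F) :=
      Ideal.ext fun _ => Iff.rfl
    rw [← h2, ← h1]
  have hpPF : (2 : integralClosure R F) ∈ 𝔓.under (integralClosure R F) := by
    rw [Ideal.under_def, Ideal.mem_comap, map_ofNat]; exact hpP
  have hp𝔭F : (2 : R) ∉ ((𝔓.under (integralClosure R F)).under R) ^ 2 := by
    rw [Ideal.under_under]; exact hp𝔭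
  obtain ⟨t, ht1, -, hdF, hlt⟩ := exists_jump_of_prime_degree R (𝔓.under (integralClosure R F))
    hpF hp hcardF htotF (by exact_mod_cast hpPF) (by exact_mod_cast hp𝔭F)
  have hcomap : 𝔓.comap (F.integralClosureInclusion R) = 𝔓.under (integralClosure R F) :=
    Ideal.ext fun _ => Iff.rfl
  refine ⟨t + 1, by omega, ?_⟩
  have hfs : (∑ᶠ (s : L ≃ₐ[K] L) (_ : s ∈ F.fixingSubgroup ∧ s ≠ 1), lowerIndex 𝔓 (L ≃ₐ[K] L) s) =
      ∑ᶠ (s : L ≃ₐ[K] L) (_ : s ∈ H ∧ s ≠ 1), lowerIndex 𝔓 (L ≃ₐ[K] L) s := by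
    simp_rw [hΓ]
  rw [hE1, he, hcomap, hdF, hfs]
  norm_num

/-! ### Klein four-subgroups generated by two commuting involutions -/

/-- In a commutative group, two distinct involutions `u, v` generate `{1, u, v, uv}`. [folklore] -/
theorem mem_zpowers_sup_zpowers_iff {G : Type*} [Group G] [IsMulCommutative G] {u v : G} (hu : u ^ 2 = 1)
    (hv : v ^ 2 = 1) (x : G) :
    x ∈ Subgroup.zpowers u ⊔ Subgroup.zpowers v ↔ x = 1 ∨ x = u ∨ x = v ∨ x = u * v := by
  have hzu : ∀ y : G, y ^ 2 = 1 → ∀ x : G, x ∈ Subgroup.zpowers y ↔ x = 1 ∨ x = y := by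
    intro y hy x
    constructor
    · rintro ⟨k, rfl⟩
      dsimp only
      rcases Int.even_or_odd k with ⟨j, rfl⟩ | ⟨j, rfl⟩
      · left; rw [← two_mul, zpow_mul, zpow_ofNat, hy, one_zpow]
      · right; rw [zpow_add, zpow_mul, zpow_ofNat, hy, one_zpow, one_mul, zpow_one]
    · rintro (rfl | rfl)
      · exact Subgroup.one_mem _
      · exact Subgroup.mem_zpowers _
  rw [Subgroup.mem_sup]
  constructor
  · rintro ⟨y, hy, z, hz, rfl⟩
    rcases (hzu u hu y).mp hy with rfl | rfl <;> rcases (hzu v hv z).mp hz with rfl | rfl <;> simp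
  · rintro (rfl | rfl | rfl | rfl)
    · exact ⟨1, Subgroup.one_mem _, 1, Subgroup.one_mem _, mul_one _⟩
    · exact ⟨_, Subgroup.mem_zpowers _, 1, Subgroup.one_mem _, mul_one _⟩
    · exact ⟨1, Subgroup.one_mem _, _, Subgroup.mem_zpowers _, one_mul _⟩
    · exact ⟨u, Subgroup.mem_zpowers u, v, Subgroup.mem_zpowers v, rfl⟩

/-- Two distinct commuting involutions `u ≠ v` (both `≠ 1`) generate a subgroup of order `4`, and a
sum over its nontrivial elements is `f u + f v + f (uv)`. [folklore] -/
theorem card_zpowers_sup_zpowers {G : Type*} [Group G] [IsMulCommutative G] {u v : G} (hu : u ^ 2 = 1)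
    (hv : v ^ 2 = 1) (hu1 : u ≠ 1) (hv1 : v ≠ 1) (huv : u ≠ v) :
    Nat.card (Subgroup.zpowers u ⊔ Subgroup.zpowers v : Subgroup G) = 4 ∧
      ∀ f : G → ℕ∞, ∑ᶠ (s : G) (_ : s ∈ Subgroup.zpowers u ⊔ Subgroup.zpowers v ∧ s ≠ 1), f s =
        f u + f v + f (u * v) := by
  classical
  have huv1 : u * v ≠ 1 := by
    intro h
    apply huv
    have : u = v⁻¹ := eq_inv_of_mul_eq_one_left h
    rw [this, inv_eq_iff_mul_eq_one, ← pow_two, hv]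
  have huvu : u * v ≠ u := by intro h; exact hv1 (mul_left_cancel (h.trans (mul_one u).symm))
  have huvv : u * v ≠ v := by intro h; exact hu1 (mul_right_cancel (h.trans (one_mul v).symm))
  have hset : ((Subgroup.zpowers u ⊔ Subgroup.zpowers v : Subgroup G) : Set G) =
      ({1, u, v, u * v} : Finset G) := by
    ext x
    simp only [SetLike.mem_coe, mem_zpowers_sup_zpowers_iff hu hv, Finset.coe_insert,
      Finset.coe_singleton, Set.mem_insert_iff, Set.mem_singleton_iff]
  have hcard4 : ({1, u, v, u * v} : Finset G).card = 4 := by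
    rw [Finset.card_insert_of_notMem (by simp [hu1.symm, hv1.symm, huv1.symm]),
      Finset.card_insert_of_notMem (by simp [huv, huvu.symm]),
      Finset.card_insert_of_notMem (by simp [huvv.symm]), Finset.card_singleton]
  constructor
  · rw [← SetLike.coe_sort_coe, hset, Nat.card_coe_set_eq, Set.ncard_coe_finset, hcard4]
  · intro f
    rw [finsum_cond_eq_sum_of_cond_iff (t := ({u, v, u * v} : Finset G)) _ (fun {x} _ => by
      simp only [mem_zpowers_sup_zpowers_iff hu hv, Finset.mem_insert, Finset.mem_singleton]
      constructor
      · rintro ⟨h | h | h | h, h1⟩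
        · exact absurd h h1
        · exact Or.inl h
        · exact Or.inr (Or.inl h)
        · exact Or.inr (Or.inr h)
      · rintro (h | h | h)
        · exact ⟨Or.inr (Or.inl h), h ▸ hu1⟩
        · exact ⟨Or.inr (Or.inr (Or.inl h)), h ▸ hv1⟩
        · exact ⟨Or.inr (Or.inr (Or.inr h)), h ▸ huv1⟩)]
    rw [Finset.sum_insert (by simp [huv, huvu.symm]), Finset.sum_insert (by simp [huvv.symm]),
      Finset.sum_singleton, add_assoc]

/-! ### Marcus, Ex. 32: no `(ℤ/2ℤ)³` -/

/-- **No elementary abelian extension of order `8`, totally ramified at an absolutely unramified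
prime with residue field `𝔽₂`** (the core of Marcus, Ch. 4, Ex. 32, in Hilbert's formulation).
Let `L/K` be Galois with group `G ≅ (ℤ/2ℤ)³`, `𝔓` a prime of `S = S_L` totally ramified over
`𝔭 = 𝔓 ∩ R` with `#(S/𝔓) = 2` and `2 ∈ 𝔭 ∖ 𝔭²`.  Then (Ex. 26) the ramification groups drop by
factors `≤ 2`, so `G = V_a ⊋ V_{a+1} = ⋯ = V_b ⊋ V_{b+1} = ⋯ = V_c ⊋ V_{c+1} = 1` with
`#V_{a+1} = 4`, `#V_{b+1} = 2`, and `i_G` takes the values `a+1, b+1, c+1` off `V_{a+1}`, on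
`V_{a+1} ∖ V_{b+1}`, on `V_{b+1} ∖ 1`.  Computing `v_𝔓(𝔇_{S/R})` along the three Klein subgroups
`⟨z, y⟩, ⟨z, x⟩, ⟨y, x⟩` (`z ∈ V_{b+1} ∖ 1`, `y ∈ V_{a+1} ∖ V_{b+1}`, `x ∉ V_{a+1}`) by
`exists_emultiplicity_differentIdeal_eq_of_card_eq_four` (each quadratic subfield has
`d ∈ {2, 3}` by Ex. 33) gives `b - a = 2(d₂ - d₁)`, forcing `b = a + 2`, and then
`c + b + 8 = 2a + 4d₃ ≤ 2a + 12`, i.e. `c ≤ b`, a contradiction.  Over `ℚ` this says: no abelian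
number field with Galois group `(ℤ/2ℤ)³` is totally ramified at `2` — the step of Ex. 32 that
pins the `2`-power layer of an abelian field unramified outside `2` inside `ℚ(ζ_{2^m})`.
[cite: Marcus2018, Ch. 4, Ex. 32–33 (pp. 101–102)] -/
theorem not_totally_ramified_of_card_eq_eight
    [IsDedekindDomain (integralClosure R L)] [Module.IsTorsionFree R (integralClosure R L)]
    [IsMulCommutative (L ≃ₐ[K] L)]
    (𝔓 : Ideal (integralClosure R L)) [𝔓.IsMaximal] (h𝔓 : 𝔓 ≠ ⊥)
    [Finite (integralClosure R L ⧸ 𝔓)] (hcard : Nat.card (L ≃ₐ[K] L) = 8)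
    (hexp : ∀ g : L ≃ₐ[K] L, g ^ 2 = 1)
    (hres : Nat.card (integralClosure R L ⧸ 𝔓) = 2)
    (htot : 𝔓.inertia (L ≃ₐ[K] L) = ⊤)
    (hpP : (2 : integralClosure R L) ∈ 𝔓) (hp𝔭 : (2 : R) ∉ (𝔓.under R) ^ 2) : False := by
  classical
  haveI : Fintype (L ≃ₐ[K] L) := Fintype.ofFinite _
  haveI h𝔓prime : 𝔓.IsPrime := Ideal.IsMaximal.isPrime inferInstance
  haveI : FaithfulSMul (L ≃ₐ[K] L) (integralClosure R L) := faithfulSMul_algEquiv_integralClosure R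
  letI : Field (integralClosure R L ⧸ 𝔓) := Ideal.Quotient.field 𝔓
  -- abstract the filtration `V n = V_n(𝔓)`
  obtain ⟨V, hV⟩ : ∃ V : ℕ → Subgroup (L ≃ₐ[K] L),
      ∀ n, 𝔓.ramificationSubgroup (L ≃ₐ[K] L) n = V n := ⟨_, fun _ => rfl⟩
  have hV0 : V 0 = ⊤ := by rw [← hV]; exact ramificationSubgroup_zero_eq_top R 𝔓 htot
  have hchar : ringChar (integralClosure R L ⧸ 𝔓) = 2 := by
    have h1 : ringChar (integralClosure R L ⧸ 𝔓) ∣ 2 := by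
      refine ringChar.dvd ?_
      rw [Nat.cast_ofNat, ← map_ofNat (Ideal.Quotient.mk 𝔓) 2, Ideal.Quotient.eq_zero_iff_mem]
      exact hpP
    rcases (Nat.dvd_prime Nat.prime_two).mp h1 with h | h
    · exact absurd h CharP.ringChar_ne_one
    · exact h
  have hV1 : V 1 = ⊤ := by
    have hcop := relIndex_ramificationSubgroup_one_coprime_ringChar (G := L ≃ₐ[K] L) h𝔓
    rw [hV, hV, hV0, Subgroup.relIndex_top_right, hchar] at hcop
    have hdvd : (V 1).index ∣ 2 ^ 3 := by
      have := Subgroup.index_dvd_card (V 1); rwa [hcard] at this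
    exact Subgroup.index_eq_one.mp (Nat.Coprime.eq_one_of_dvd (Nat.Coprime.pow_right 3 hcop) hdvd)
  have hanti : ∀ {m n : ℕ}, m ≤ n → V n ≤ V m := fun h => by
    rw [← hV, ← hV]; exact 𝔓.ramificationSubgroup_antitone _ h
  have hstep : ∀ n, 1 ≤ n → Nat.card (V n) ∣ 2 * Nat.card (V (n + 1)) := by
    intro n hn
    have hdvd := relIndex_ramificationSubgroup_succ_dvd (G := L ≃ₐ[K] L) h𝔓 hn
    rw [hres, hV, hV] at hdvd
    have hmul : Nat.card ((V (n + 1)).subgroupOf (V n)) * (V (n + 1)).relIndex (V n) =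
        Nat.card (V n) := Subgroup.card_mul_index _
    rw [Nat.card_congr (Subgroup.subgroupOfEquivOfLe (hanti (Nat.le_succ n))).toEquiv] at hmul
    rw [← hmul, mul_comm 2]
    exact Nat.mul_dvd_mul_left _ hdvd
  obtain ⟨N, hN⟩ : ∃ N, V N = ⊥ := by
    obtain ⟨N, hN⟩ := Ideal.ramificationSubgroup_eventually_eq_bot_holds 𝔓 (L ≃ₐ[K] L)
      (Ideal.IsMaximal.ne_top inferInstance)
    exact ⟨N, by rw [← hV]; exact hN N le_rfl⟩
  have hi_le : ∀ {s : L ≃ₐ[K] L} {i : ℕ}, s ∉ V i → lowerIndex 𝔓 (L ≃ₐ[K] L) s ≤ i :=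
    fun h => by rw [lowerIndex_le_natCast_iff, hV]; exact h
  have hi_ge : ∀ {s : L ≃ₐ[K] L} {i : ℕ}, s ∈ V i →
      ((i + 1 : ℕ) : ℕ∞) ≤ lowerIndex 𝔓 (L ≃ₐ[K] L) s := fun {s i} h => by
    have := add_one_le_lowerIndex 𝔓 (G := L ≃ₐ[K] L) (s := s) (i := i) (by rw [hV]; exact h)
    exact_mod_cast this
  have hcardV : ∀ n, V n = ⊤ → Nat.card (V n) = 8 := fun n h => by
    rw [h, Subgroup.card_top, hcard]
  -- the first jump `a`: `V a = G`, `#V (a+1) = 4`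
  have hex8 : ∃ n, Nat.card (V n) < 8 := ⟨N, by rw [hN, Subgroup.card_bot]; norm_num⟩
  have hn8 : 2 ≤ Nat.find hex8 := by
    by_contra hlt
    have h := Nat.find_spec hex8
    rcases Nat.le_one_iff_eq_zero_or_eq_one.mp (by omega : Nat.find hex8 ≤ 1) with h' | h'
    · rw [h', hcardV 0 hV0] at h; exact lt_irrefl _ h
    · rw [h', hcardV 1 hV1] at h; exact lt_irrefl _ h
  set a := Nat.find hex8 - 1 with ha
  have ha1 : 1 ≤ a := by omega
  have hVa : V a = ⊤ := by
    have h := Nat.find_min hex8 (show a < Nat.find hex8 by omega)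
    rw [not_lt] at h
    have hle : Nat.card (V a) ≤ 8 := hcard ▸ Subgroup.card_le_card_group (V a)
    exact (Subgroup.card_eq_iff_eq_top (H := V a)).mp (by rw [hcard]; omega)
  have hA4 : Nat.card (V (a + 1)) = 4 := by
    have hlt : Nat.card (V (a + 1)) < 8 := by
      have := Nat.find_spec hex8; rwa [show Nat.find hex8 = a + 1 by omega] at this
    have hdvd : Nat.card (V (a + 1)) ∣ 2 ^ 3 := by
      have := Subgroup.card_subgroup_dvd_card (V (a + 1)); rwa [hcard] at this
    have hst := hstep a ha1
    rw [hcardV a hVa] at hst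
    obtain ⟨k, hk, hk'⟩ := (Nat.dvd_prime_pow Nat.prime_two).mp hdvd
    rw [hk'] at hlt hst ⊢
    revert hlt hst
    interval_cases k <;> norm_num
  -- the second jump `b`: `V b = V (a+1)`, `#V (b+1) = 2`
  have hex4 : ∃ n, Nat.card (V n) < 4 := ⟨N, by rw [hN, Subgroup.card_bot]; norm_num⟩
  have hn4 : a + 2 ≤ Nat.find hex4 := by
    by_contra hlt
    have h := Nat.find_spec hex4
    have := Subgroup.card_le_of_le (hanti (show Nat.find hex4 ≤ a + 1 by omega))
    rw [hA4] at this
    omega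
  set b := Nat.find hex4 - 1 with hb
  have hab : a + 1 ≤ b := by omega
  have hVb : V b = V (a + 1) := by
    have h := Nat.find_min hex4 (show b < Nat.find hex4 by omega)
    rw [not_lt] at h
    exact Subgroup.eq_of_le_of_card_ge (hanti hab) (by rw [hA4]; exact h)
  have hB2 : Nat.card (V (b + 1)) = 2 := by
    have hlt : Nat.card (V (b + 1)) < 4 := by
      have := Nat.find_spec hex4; rwa [show Nat.find hex4 = b + 1 by omega] at this
    have hdvd : Nat.card (V (b + 1)) ∣ 2 ^ 2 := by
      have := Subgroup.card_dvd_of_le (hanti (Nat.le_succ b)); rwa [hVb, hA4] at this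
    have hst := hstep b (by omega)
    rw [hVb, hA4] at hst
    obtain ⟨k, hk, hk'⟩ := (Nat.dvd_prime_pow Nat.prime_two).mp hdvd
    rw [hk'] at hlt hst ⊢
    revert hlt hst
    interval_cases k <;> norm_num
  -- the third jump `c`: `V c = V (b+1)`, `V (c+1) = 1`
  have hex2 : ∃ n, Nat.card (V n) < 2 := ⟨N, by rw [hN, Subgroup.card_bot]; norm_num⟩
  have hn2 : b + 2 ≤ Nat.find hex2 := by
    by_contra hlt
    have h := Nat.find_spec hex2
    have := Subgroup.card_le_of_le (hanti (show Nat.find hex2 ≤ b + 1 by omega))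
    rw [hB2] at this
    omega
  set c := Nat.find hex2 - 1 with hc
  have hbc : b + 1 ≤ c := by omega
  have hVc : V c = V (b + 1) := by
    have h := Nat.find_min hex2 (show c < Nat.find hex2 by omega)
    rw [not_lt] at h
    exact Subgroup.eq_of_le_of_card_ge (hanti hbc) (by rw [hB2]; exact h)
  have hVc1 : V (c + 1) = ⊥ := by
    have hlt : Nat.card (V (c + 1)) < 2 := by
      have := Nat.find_spec hex2; rwa [show Nat.find hex2 = c + 1 by omega] at this
    have hpos : 0 < Nat.card (V (c + 1)) := Nat.card_pos
    exact Subgroup.card_eq_one.mp (by omega)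
  -- the values of `i_G`
  have hi_out : ∀ g, g ∉ V (a + 1) → lowerIndex 𝔓 (L ≃ₐ[K] L) g = ((a + 1 : ℕ) : ℕ∞) :=
    fun g hg => le_antisymm (hi_le hg) (hi_ge (by rw [hVa]; exact Subgroup.mem_top g))
  have hi_mid : ∀ g, g ∈ V (a + 1) → g ∉ V (b + 1) →
      lowerIndex 𝔓 (L ≃ₐ[K] L) g = ((b + 1 : ℕ) : ℕ∞) :=
    fun g hg hg' => le_antisymm (hi_le hg') (hi_ge (by rw [hVb]; exact hg))
  have hi_in : ∀ g, g ∈ V (b + 1) → g ≠ 1 → lowerIndex 𝔓 (L ≃ₐ[K] L) g = ((c + 1 : ℕ) : ℕ∞) :=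
    fun g hg hg1 => le_antisymm
      (hi_le (by rw [hVc1]; exact fun h => hg1 (Subgroup.mem_bot.mp h)))
      (hi_ge (by rw [hVc]; exact hg))
  -- elements `x ∉ V (a+1)`, `y ∈ V (a+1) ∖ V (b+1)`, `z ∈ V (b+1) ∖ 1`
  obtain ⟨x, hx⟩ : ∃ x : L ≃ₐ[K] L, x ∉ V (a + 1) := by
    by_contra h
    push Not at h
    have : V (a + 1) = ⊤ := eq_top_iff.mpr fun g _ => h g
    rw [this, Subgroup.card_top, hcard] at hA4
    omega
  obtain ⟨y, hy, hy'⟩ : ∃ y, y ∈ V (a + 1) ∧ y ∉ V (b + 1) := by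
    have hlt' : V (b + 1) < V (a + 1) :=
      lt_of_le_of_ne (hanti (by omega)) fun h => by rw [h, hA4] at hB2; omega
    obtain ⟨y, hy, hy'⟩ := SetLike.exists_of_lt hlt'
    exact ⟨y, hy, hy'⟩
  obtain ⟨z, hz, hz1⟩ : ∃ z, z ∈ V (b + 1) ∧ z ≠ 1 := by
    rcases (V (b + 1)).bot_or_exists_ne_one with h | ⟨z, hz, hz1⟩
    · rw [h, Subgroup.card_bot] at hB2; omega
    · exact ⟨z, hz, hz1⟩
  have hx1 : x ≠ 1 := fun h => hx (h ▸ Subgroup.one_mem _)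
  have hy1 : y ≠ 1 := fun h => hy' (h ▸ Subgroup.one_mem _)
  have hzA : z ∈ V (a + 1) := hanti (by omega) hz
  have hzy : z ≠ y := fun h => hy' (h ▸ hz)
  have hzx : z ≠ x := fun h => hx (h ▸ hzA)
  have hyx : y ≠ x := fun h => hx (h ▸ hy)
  have hzyA : z * y ∈ V (a + 1) := Subgroup.mul_mem _ hzA hy
  have hzyB : z * y ∉ V (b + 1) := fun h =>
    hy' (by simpa using Subgroup.mul_mem _ (Subgroup.inv_mem _ hz) h)
  have hzxA : z * x ∉ V (a + 1) := fun h =>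
    hx (by simpa using Subgroup.mul_mem _ (Subgroup.inv_mem _ hzA) h)
  have hyxA : y * x ∉ V (a + 1) := fun h =>
    hx (by simpa using Subgroup.mul_mem _ (Subgroup.inv_mem _ hy) h)
  -- the different along the three Klein subgroups `⟨z, y⟩`, `⟨z, x⟩`, `⟨y, x⟩`
  obtain ⟨c1, s1⟩ := card_zpowers_sup_zpowers (hexp z) (hexp y) hz1 hy1 hzy
  obtain ⟨c2, s2⟩ := card_zpowers_sup_zpowers (hexp z) (hexp x) hz1 hx1 hzx
  obtain ⟨c3, s3⟩ := card_zpowers_sup_zpowers (hexp y) (hexp x) hy1 hx1 hyx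
  obtain ⟨d1, hd1, e1⟩ :=
    exists_emultiplicity_differentIdeal_eq_of_card_eq_four R 𝔓 h𝔓 hcard htot hpP hp𝔭 _ c1
  obtain ⟨d2, hd2, e2⟩ :=
    exists_emultiplicity_differentIdeal_eq_of_card_eq_four R 𝔓 h𝔓 hcard htot hpP hp𝔭 _ c2
  obtain ⟨d3, hd3, e3⟩ :=
    exists_emultiplicity_differentIdeal_eq_of_card_eq_four R 𝔓 h𝔓 hcard htot hpP hp𝔭 _ c3
  rw [s1 (lowerIndex 𝔓 (L ≃ₐ[K] L)), hi_in z hz hz1, hi_mid y hy hy', hi_mid (z * y) hzyA hzyB]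
    at e1
  rw [s2 (lowerIndex 𝔓 (L ≃ₐ[K] L)), hi_in z hz hz1, hi_out x hx, hi_out (z * x) hzxA] at e2
  rw [s3 (lowerIndex 𝔓 (L ≃ₐ[K] L)), hi_mid y hy hy', hi_out x hx, hi_out (y * x) hyxA] at e3
  rw [e1] at e2 e3
  have h12 : (c + 1) + (b + 1) + (b + 1) + 4 * d1 = (c + 1) + (a + 1) + (a + 1) + 4 * d2 := by
    exact_mod_cast e2
  have h13 : (c + 1) + (b + 1) + (b + 1) + 4 * d1 = (b + 1) + (a + 1) + (a + 1) + 4 * d3 := by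
    exact_mod_cast e3
  omega

end Literature.NumberTheory.GaloisRepresentations
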